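import Summits.CriticalPhenomena.PercolationContinuityZ3.Theorems.Transplant.PlanarSkeletonFrmScaledDefs
import Mathlib.Algebra.Order.Group.End
import HarnessLib

/-!
# Every ONE-TYPE scaled skeleton carrier has a TRANSITIVE chart-translating automorphism group with two independent characters — the interface of
# the node `U_s` versus the input of `AutScaled.criticalContinuity`: the only extra hypothesis of the conditional theorem is FINITE STABILISERS (kernel)

builds on p205010 (kernel theorem, internal audit signed; external expert review pending) — nothing in this file uses p205010; unconditional, no node
(the OPEN node `SamePDropOfSkeletonFrmScaled₁` is only mentioned).  Lane `prim-bschramm`, seat `prim-bschramm-p4` gen 24 (PART C3 of `P4-GENERAL.md`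
§46).  Helper file (`--supports stmt-CriticalPhenomena-4575 --as helper`).

THE POINT ("INPUT(G) as weak as you can make it — be exact").  The conditional theorem of record, `AutScaled.criticalContinuity`, takes: a TRANSITIVE
group `A` of automorphisms with FINITE stabilisers and two independent characters (`b₁(A) ≥ 2`), and builds a one-type `PlanarSkeletonFrmScaled`
structure — the interface of the open node `U_s`.  Conversely (this file): **from ANY one-type `PlanarSkeletonFrmScaled` structure `Φ` on `G` the
chart-translating automorphisms `A_Φ = {α : G ≃g G | ∃ d, ∀ w, φ(α w) = φ w + d}` form a subgroup of `Aut(G)` that is TRANSITIVE (the frames lie in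
it) and has TWO INDEPENDENT CHARACTERS `α ↦ (φ(α t) − φ t)ᵢ` (the frames of the two exact `N`-steps at `t` take the values `N e₀`, `N e₁`)**
(`FrmScaledAut.translating_transitive_rankTwo`).  So, up to the node's own (κ′) field, the graph-level input "one-type scaled skeleton" and the
chart-free input "transitive `A ≤ Aut(G)` with `b₁(A) ≥ 2`" differ EXACTLY by the finiteness of the stabilisers (needed in `AutScaled` for Milnor's
lemma / the kernel's finite generation); nothing else is hidden in the interface.  Pure algebra; def-free (the subgroup is built inside the proof).
[cite: BenjaminiSchramm1996, §2 (almost transitive graphs); Conj. 4] [cite: KozmaNitzan2024, §4 p. 16 (Lemma 8: the role of the lattice symmetries)]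
-/

noncomputable section

namespace Summit.CriticalPhenomena.PercolationContinuityZ3.Theorems.Transplant

open SimpleGraph Literature.Probability.LatticeModels
open scoped Classical

namespace FrmScaledAut

variable {V : Type} {G : SimpleGraph V} [G.LocallyFinite]

omit [G.LocallyFinite] in
/-- **The chart-translating automorphisms form a subgroup of `Aut(G)`** (translations compose and invert). [folklore] -/
theorem exists_translatingSubgroup (φ : V → Site 2) :
    ∃ A : Subgroup (G ≃g G), ∀ α : G ≃g G, α ∈ A ↔ ∃ d : Site 2, ∀ w, φ (α w) = φ w + d := by
  let A : Subgroup (G ≃g G) :=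
    { carrier := {α | ∃ d : Site 2, ∀ w, φ (α w) = φ w + d}
      one_mem' := ⟨0, fun w => by simp [RelIso.one_apply]⟩
      mul_mem' := fun {α β} hα hβ => by
        obtain ⟨d₁, h₁⟩ := hα
        obtain ⟨d₂, h₂⟩ := hβ
        exact ⟨d₂ + d₁, fun w => by rw [RelIso.mul_apply, h₁, h₂, add_assoc]⟩
      inv_mem' := fun {α} hα => by
        obtain ⟨d, h⟩ := hα
        refine ⟨-d, fun w => ?_⟩
        have key := h (α⁻¹ w)
        rw [RelIso.apply_inv_self] at key
        rw [key]; abel }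
  exact ⟨A, fun α => Iff.rfl⟩

/-- **THEOREM (the one-type interface, unpacked): every one-type `PlanarSkeletonFrmScaled` structure on `G` yields a subgroup `A ≤ Aut(G)` which
(i) translates the chart, `φ(α w) = φ w + (φ(α t) − φ t)` for `α ∈ A`; (ii) is TRANSITIVE; (iii) has two INDEPENDENT characters.**
(Stabilisers of `A` need not be finite — that is the one extra hypothesis of `AutScaled.criticalContinuity`.)
[cite: BenjaminiSchramm1996, §2 (almost transitive graphs); Conj. 4] [cite: KozmaNitzan2024, §4 p. 16 (Lemma 8)] -/
theorem translating_transitive_rankTwo (Φ : PlanarSkeletonFrmScaled G) {t : V} (ht : Φ.types = {t}) :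
    ∃ A : Subgroup (G ≃g G),
      (∀ α ∈ A, ∀ w, Φ.φ (α w) = Φ.φ w + (Φ.φ (α t) - Φ.φ t)) ∧
      (∀ v : V, ∃ α ∈ A, α t = v) ∧
      ∃ (ψ₀ ψ₁ : A →* Multiplicative ℤ) (a b : A),
        Multiplicative.toAdd (ψ₀ a) * Multiplicative.toAdd (ψ₁ b) ≠ Multiplicative.toAdd (ψ₁ a) * Multiplicative.toAdd (ψ₀ b) := by
  obtain ⟨A, hA⟩ := exists_translatingSubgroup (G := G) Φ.φ
  -- (i) the translation vector of `α ∈ A` is `φ(α t) − φ t`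
  have htrans : ∀ α ∈ A, ∀ w, Φ.φ (α w) = Φ.φ w + (Φ.φ (α t) - Φ.φ t) := by
    intro α hα w
    obtain ⟨d, hd⟩ := (hA α).1 hα
    rw [hd w, hd t, add_sub_cancel_left]
  -- (ii) frames lie in `A`; transitivity
  have hframe : ∀ v : V, ∃ α ∈ A, α t = v := by
    intro v
    obtain ⟨t', ht', α, hαt, hαw⟩ := Φ.frame v
    rw [ht, Finset.mem_singleton] at ht'
    subst ht'
    exact ⟨α, (hA α).2 ⟨Φ.φ v - Φ.φ t', hαw⟩, hαt⟩
  refine ⟨A, htrans, hframe, ?_⟩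
  -- (iii) the coordinate characters on `A`
  have hmul : ∀ a b : A, Φ.φ (((a * b : A) : G ≃g G) t) - Φ.φ t = (Φ.φ ((a : G ≃g G) t) - Φ.φ t) + (Φ.φ ((b : G ≃g G) t) - Φ.φ t) := by
    intro a b
    rw [Subgroup.coe_mul, RelIso.mul_apply, htrans a a.2 ((b : G ≃g G) t)]; abel
  have hchar : ∀ i : Fin 2, ∃ ψ : A →* Multiplicative ℤ, ∀ a : A, Multiplicative.toAdd (ψ a) = (Φ.φ ((a : G ≃g G) t) - Φ.φ t) i := fun i =>
    ⟨{ toFun := fun a => Multiplicative.ofAdd ((Φ.φ ((a : G ≃g G) t) - Φ.φ t) i),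
       map_one' := by simp [RelIso.one_apply],
       map_mul' := fun a b => by rw [← ofAdd_add, hmul a b, Pi.add_apply] }, fun a => rfl⟩
  obtain ⟨ψ₀, hψ₀⟩ := hchar 0
  obtain ⟨ψ₁, hψ₁⟩ := hchar 1
  -- the frames of the two exact `N`-steps at `t`
  have hstepA : ∀ i : Fin 2, ∃ a : A, Φ.φ ((a : G ≃g G) t) - Φ.φ t = Pi.single i (Φ.N : ℤ) := by
    intro i
    obtain ⟨v, -, hv⟩ := Φ.step t i 1
    obtain ⟨α, hα, hαt⟩ := hframe v
    exact ⟨⟨α, hα⟩, by rw [Subgroup.coe_mk, hαt, hv, Units.val_one, mul_one, add_sub_cancel_left]⟩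
  obtain ⟨a₀, ha₀⟩ := hstepA 0
  obtain ⟨a₁, ha₁⟩ := hstepA 1
  have hN' : Φ.N ≠ 0 := by have := Φ.one_le_N; omega
  refine ⟨ψ₀, ψ₁, a₀, a₁, ?_⟩
  rw [hψ₀, hψ₁, hψ₀, hψ₁, ha₀, ha₁]
  simp [hN']

omit [G.LocallyFinite] in
/-- **Stabilisers of the translating group preserve the chart exactly**: `α ∈ A`, `α t = t` ⟹ `φ ∘ α = φ` — the (possibly infinite) part of
`Aut(G)` that the finite-stabiliser hypothesis of `AutScaled.criticalContinuity` excludes. [folklore] -/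
theorem stabilizer_preserves_chart (φ : V → Site 2) {t : V} {α : G ≃g G} (hα : ∀ w, φ (α w) = φ w + (φ (α t) - φ t)) (hfix : α t = t)
    (w : V) : φ (α w) = φ w := by
  rw [hα w, hfix, sub_self, add_zero]

end FrmScaledAut

end Summit.CriticalPhenomena.PercolationContinuityZ3.Theorems.Transplant

end
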